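import Summits.BirchSwinnertonDyer.Rank1Residual.X1.CongruenceTransfer
import HarnessLib

/-!
# Route D — DESCENT WITNESSES for Greenberg–Vatsal's residual Selmer group on the leaf X1 ∩ {r = 0}:
# `dim_{𝔽_p} Sel_n(E₀[p]/ℚ_n) ≤ λ_alg(E₀) + δ + Σ_ℓ g_ℓ(n)·d_ℓ(E₀)` ⇒ (squeeze of route T)
# Mazur's main conjecture and `BSD(E,p)` at `E₀`

HONEST FRAMING (cell `b2b-bsdres`, run/shared/lean/b2b/bsd-rank1-residual/, verbatim in every
file): the goal of the cell is to DELETE the COMBINATION-SHAPED residual classes of the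
Birch–Swinnerton-Dyer formula for ALL analytic-rank `≤ 1` elliptic curves over `ℚ` — "full BSD
formula for every rank `≤ 1` curve in class `C`" assembled STRICTLY from published theorems — so
that the rank-`≤ 1` remainder becomes exactly the CONSTRUCTION-SHAPED classes, which are TYPED
(missing-input `Prop`s), NOT attempted. This is not "finishing BSD". Sub-cell
`b2b-bsdres-eisenstein-p1` (CLASS-OWNERS row "X1 (r=0)"), gen 8: research route; NO CLAIM BEYOND
STATED CLASSES; nothing here changes a label. ONE def, a typed per-pair input (`ResidualDescentBound`,
nothing asserted); everything else is a theorem over PUBLISHED named facts (`hW16` Wuthrich 2014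
Thm. 16, `h310` Greenberg Prop. 3.10, `hGr` Greenberg Thm. 4.1, `hmod` modularity, `hGZK`
Gross–Zagier–Kolyvagin) and the cell's typed per-pair inputs `AnalyticMuLE`, `AnalyticLambdaEq`.

WHY THIS FILE. Routes P/T/C (gens 5–6) bound `λ_alg(E₀) = λ(X(E₀/ℚ_∞))` from below by parity,
Tamagawa kernels over the tower and points over `ℚ_1`; route G (gen 7) transfers `λ` EXACTLY inside a
congruence family `{E : E[3] ≅ E₀[3]}` — and on the census at `p = 3`, `N < 2·10⁴` the residue of the
leaf is 65 such families in which NO member is reached by S/P/T/C (HOME/b2b-bsdres-eisenstein-p1/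
X1R0-GAPMAP.md §16.2: the congruence invariant `ν(E[3]) ≥ 2`, e.g. the 20-class family of `44a1`).
Greenberg–Vatsal's own argument (Invent. Math. 142 (2000) §2, arXiv:math/9906215 pp. 25–27) says
where ALL the zeros live: for the `μ = 0` member `E₀` of a leaf class, with `A = E₀[p^∞]`,
`D = A/F⁺A`, `Σ₀` = the bad primes, `δ = [E₀(ℚ)[p] ≠ 0]`,
  `dim_{𝔽_p} S^{Σ₀}_{A[p]}(ℚ_∞) = λ^{Σ₀}(E₀) + δ = λ_alg(E₀) + Σ_{ℓ∈Σ₀} s_ℓ d_ℓ(E₀) + δ`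
(Prop. (2.8) / the kernel theorem `X2.GreenbergVatsalTorsionCurve.natCard_gvSelmerInfty_torsion_rat_goodOrdinary`
of sub-cell eisenstein-p2 for the `+δ`; Cor. (2.3), Prop. (2.4); Greenberg LNM 1716 Prop. 4.15 / p. 161:
`X(E₀/ℚ_∞)` has no nonzero finite `Λ`-submodule, so `dim S_A(ℚ_∞)[p] = λ` EXACTLY when `μ = 0`).
Here `S^{Σ₀}_{A[p]}(ℚ_∞)` is a finite `𝔽_p`-space of EXPLICIT Kummer classes of the RESIDUAL
representation, and every class of it defined over a finite layer `ℚ_n` is a WITNESS. Precisely,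
with `𝔭_n` the prime of `ℚ_n` over `p`, `I_{𝔭_n}` an inertia group, and
  `Sel_n := ker( H¹(ℚ_Σ/ℚ_n, E₀[p]) → H¹(I_{𝔭_n}, D[p]) )`
(Greenberg's condition on INERTIA at `p`, NO condition at `ℓ ∈ Σ₀`, unramified outside `Σ`):
**ROUTE D: `dim_{𝔽_p} Sel_n ≤ λ_alg(E₀) + δ + Σ_{ℓ∈Σ₀} g_ℓ(n) d_ℓ(E₀)`**, `g_ℓ(n) = min(s_ℓ, pⁿ)`
the number of primes of `ℚ_n` over `ℓ` (X1R0-GAPMAP §17.1: restriction `Sel_n → S^{Σ₀}_{A[p]}(ℚ_∞)`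
is injective — its kernel `H¹(Γ_n, E₀(ℚ_∞)[p]) = ⟨c₀ ⊗ P⟩` misses `Sel_n` because a `ℚ_p`-rational
point of order `p` is not in the kernel of reduction and `ℚ_{n+1}/ℚ_n` is totally ramified at `𝔭_n` —
with image in the `Γ_n`-invariants, whose dimension is at most `δ + λ + Σ_ℓ g_ℓ(n) d_ℓ` by
left-exactness along `0 → A(ℚ_∞)/p → S^{Σ₀}_{A[p]} → S^{Σ₀}_A[p]` and
`0 → S_A[p] → S^{Σ₀}_A[p] → ⊕_ℓ 𝓗_ℓ[p]`, the `s_ℓ` summands of `𝓗_ℓ` over the primes of `ℚ_∞` above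
`ℓ` forming `g_ℓ(n)` orbits under `Γ_n`). The number `k = dim Sel_n` is COMPUTED EXACTLY per pair
OUTSIDE the kernel (`φ = 1` classes at `p = 3`: Kummer theory over `M_n = ℚ(ζ_{3^{n+1}}, ∛A)`,
`A ∈ ℚ^×/ℚ^{×3}` the class of the non-split extension `E₀[3]`; inflation–restriction with
`H¹(Gal(M_n/ℚ_n), E₀[3]) ≅ ℤ/3`, `H² = 0`; `S`-units of `M_n` modulo cubes by PARI `bnfinit/bnfunits`;
the Galois-equivariance equations; ONE local condition at a prime over 3 decided by `ideallog`; a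
GRH-free independence certificate by cubic-residue signatures — HOME/b2b-bsdres-eisenstein-p1/routeD/),
and route D supplies route T's typed input `AlgebraicLambdaGE W p (k − e)`, `e = δ + Σ_ℓ g_ℓ(n) d_ℓ`.
LEVEL `n = 0` reproduces Greenberg–Vatsal's level-raising count and closes nothing new (1 319 classes,
0 violations, 463 equalities with `λ_an`); LEVEL `n = 1` (`ℚ_1 = ℚ(ζ_9)⁺`, fields of degree 18) gives,
at `E₀ = 44a1 = [0,1,0,3,−1]`, `p = 3` (`A = 44`, `Σ₀ = {2, 11}`, `δ = 1`, `d_2 = 0`, `d_11 = 1`,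
`s_11 = 1`): `dim Sel_1 = 5`, hence `λ_alg ≥ 5 − 1 − 1 = 3 = λ_an − 1`, parity (Prop. 3.10) gives
`λ_alg = 4 = λ_an`: Mazur's main conjecture and `BSD(44a1, 3)` — and with route G the λ-part of all 166
classes of the `44a` congruence family (`N < 5·10⁵`).

* `ResidualDescentBound W p k e` (TYPED) — §1; `lambdaPartAt_of_residualDescentBound(_of_even)`,
  `mazurMainConjecture_of_residualDescentBound_of_even` — §2; `Leaf.mazurMainConjecture_of_residualDescent`,
  **`Leaf.bsdp_of_muZero_of_residualDescent`**, `Leaf.le_of_residualDescentBound` (consistency,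
  Kato's direction: `k − e ≤ λ_an`, the FALSIFICATION TEST of the census) — §3.

References: [GreenbergVatsal2000] §2: Props. (2.1), (2.4), (2.5), (2.8), Cor. (2.3), pp. 16–17,
23–27 of arXiv:math/9906215; [GreenbergLNM1716] Prop. 3.10, Prop. 4.15 / p. 161; [Wuthrich2014]
Thm. 16; Silverman AEC VII.3.1 (torsion of the formal group); HOME/b2b-bsdres-eisenstein-p1/
X1R0-GAPMAP.md §17.
-/

noncomputable section

open scoped Classical MatrixGroups ModularForm

open PowerSeries CongruenceSubgroup WeierstrassCurve Literature.NumberTheory.EllipticCurves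
  Literature.NumberTheory.EllipticCurves.ModularForms
  Literature.NumberTheory.EllipticCurves.Rank1Residual
  Literature.NumberTheory.EllipticCurves.Greenberg1999
  Summit.BirchSwinnertonDyer.BirchSwinnertonDyer.Theorems.Rank1ResidualX1Defs
  Summit.BirchSwinnertonDyer.Rank1Residual.X1.MuLambda
  Summit.BirchSwinnertonDyer.Rank1Residual.X1.MuPart
  Summit.BirchSwinnertonDyer.Rank1Residual.X1.ParitySqueeze
  Summit.BirchSwinnertonDyer.Rank1Residual.X1.TamagawaSqueeze

set_option autoImplicit false

namespace Summit.BirchSwinnertonDyer.Rank1Residual.X1.ResidualDescent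

/-! ## §1. The route-D statement, TYPED -/

/-- **Route D's per-pair statement "`dim Sel_n(E₀[p]) ≤ λ_alg(E₀) + e`" (TYPED; nothing asserted).**
For the cyclotomic `ℤ_p`-extension `κ`, a topological generator `γ` matching the cyclotomic variable,
and EVERY Pontryagin-dual datum `D` of `W` (finitely generated, `Λ`-torsion) with `μ(D.X) = 0`:
`k ≤ λ(D.X) + e`. INPUT of route D, supplied per pair OUTSIDE the kernel by X1R0-GAPMAP §17.1 (the
injection `Sel_n(W[p]/ℚ_n) ↪ S^{Σ₀}_{W[p]}(ℚ_∞)^{Γ_n}` and Greenberg–Vatsal's structure of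
`S^{Σ₀}_{W[p]}(ℚ_∞)`: Prop. (2.8) with eisenstein-p2's `+ dim W(ℚ)[p]`, Cor. (2.3), Prop. (2.4),
Greenberg Prop. 4.15) together with the EXACT computation of
`k = dim_{𝔽_p} ker(H¹(ℚ_Σ/ℚ_n, W[p]) → H¹(I_{𝔭_n}, W[p]/F⁺))` and of
`e = [W(ℚ)[p] ≠ 0] + Σ_{ℓ ∣ N, ℓ ≠ p} min(s_ℓ, pⁿ)·d_ℓ(W)` (`s_ℓ = p^{ord_p(ℓ^{p−1}−1)−1}`, `d_ℓ` =
multiplicity of `ℓ^{-1}` as a root of the Euler factor `P_ℓ mod p`).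
[cite: GreenbergVatsal2000, §2 Prop. (2.8), Cor. (2.3), Prop. (2.4), pp. 25–27 (shape only; nothing asserted)]
[cite: GreenbergLNM1716, Prop. 4.15 (p. 161)] -/
def ResidualDescentBound (W : WeierstrassCurve ℚ) [W.IsElliptic] [W.IsGloballyMinimal] (p : ℕ)
    [Fact p.Prime] (k e : ℕ) : Prop :=
  ∀ (κ : ZpExtension ℚ p) (γ : Field.absoluteGaloisGroup ℚ),
      κ.IsCyclotomic → κ.IsTopGenerator γ → IsCyclotomicVariable p γ →
    ∀ (D : W.SelmerDualData κ γ) [Module.Finite (IwasawaAlgebra p) D.X],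
      D.IsTorsion → D.mu = 0 → k ≤ lambdaInvariant p D.X + e

/-- `ResidualDescentBound` is monotone in the witness count: `k' ≤ k` witnesses follow from `k`.
[folklore] -/
theorem ResidualDescentBound.mono {W : WeierstrassCurve ℚ} [W.IsElliptic] [W.IsGloballyMinimal]
    {p : ℕ} [Fact p.Prime] {k k' e : ℕ} (hk : k' ≤ k) (h : ResidualDescentBound W p k e) :
    ResidualDescentBound W p k' e :=
  fun κ γ hκ hγ hγ' D _ hX hμ ↦ hk.trans (h κ γ hκ hγ hγ' D hX hμ)

/-! ## §2. The squeeze: `λ_an(E₀) = n ≤ k − e (+1 with parity)` gives the λ-part and Mazur's MC -/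

section Squeeze

variable {W : WeierstrassCurve ℚ} [W.IsElliptic] [W.IsGloballyMinimal] {p : ℕ} [Fact p.Prime]

/-- **`λ(X) ≥ k − e` at a pair with `μ_an = 0`.** Good ordinary Eisenstein `(E₀, p)`, `p ≠ 2`;
granted Wuthrich 2014 Thm. 16 (`hW16`) and modularity (`hmod`), both PUBLISHED: if `μ_an(E₀) = 0`
(`AnalyticMuLE W p 0`; then `μ(X) = 0` by Kato's divisibility, `MuPart.mu_eq_zero_of_analyticMuLE_zero`)
and `ResidualDescentBound W p k e`, then for the cyclotomic data and every dual datum `D`: `X` is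
torsion and `k ≤ λ(X) + e`. [cite: GreenbergVatsal2000, §2 Prop. (2.8), Cor. (2.3), Prop. (2.4)]
[cite: Wuthrich2014, Thm. 16 (p. 397)] -/
theorem isTorsion_and_le_lambdaInvariant_of_residualDescentBound
    (hW16 : Wuthrich2014.charIdeal_dvd_padicLFunction) (hmod : nonempty_modularParametrizationData)
    (hp : p ≠ 2) (hgood : W.HasGoodReductionAtPrime p) (hord : ¬ (p : ℤ) ∣ W.frobeniusTrace p)
    (hred : ¬ W.HasIrreducibleModPGaloisRep p) (hμ : AnalyticMuLE W p 0)
    {k e : ℕ} (hD : ResidualDescentBound W p k e)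
    {κ : ZpExtension ℚ p} {γ : Field.absoluteGaloisGroup ℚ}
    (hκ : κ.IsCyclotomic) (hγ : κ.IsTopGenerator γ) (hγ' : IsCyclotomicVariable p γ)
    (D : W.SelmerDualData κ γ) :
    D.IsTorsion ∧ k ≤ lambdaInvariant p D.X + e := by
  haveI : NeZero (W.conductorNorm ℤ) := ⟨(W.conductorNorm_pos_holds).ne'⟩
  haveI : Module.Finite (IwasawaAlgebra p) D.X := D.module_finite_holds hγ
  obtain ⟨hX, -⟩ := isTorsion_and_exists_factorisation hW16 hmod hp hgood hord hred hκ hγ hγ' D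
  have hmu : D.mu = 0 := mu_eq_zero_of_analyticMuLE_zero hW16 hmod hp hgood hord hred hμ hκ hγ hγ' D
  exact ⟨hX, hD κ γ hκ hγ hγ' D hX hmu⟩

/-- **Route D, λ-part (no parity).** If `λ_an(E₀) = n` with `n + e ≤ k`, the λ-part `LambdaPartAt W p`
holds at `E₀` (`λ(f_E·h) = n ≤ k − e ≤ λ(X) = λ(f_E)`).
[cite: GreenbergVatsal2000, §2 pp. 25–27] [cite: Wuthrich2014, Thm. 16 (p. 397)] -/
theorem lambdaPartAt_of_residualDescentBound
    (hW16 : Wuthrich2014.charIdeal_dvd_padicLFunction) (hmod : nonempty_modularParametrizationData)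
    (hp : p ≠ 2) (hgood : W.HasGoodReductionAtPrime p) (hord : ¬ (p : ℤ) ∣ W.frobeniusTrace p)
    (hred : ¬ W.HasIrreducibleModPGaloisRep p) (hμ : AnalyticMuLE W p 0)
    {k e : ℕ} (hD : ResidualDescentBound W p k e)
    {n : ℕ} (hlam : AnalyticLambdaEq W p n) (hn : n + e ≤ k) : LambdaPartAt W p := by
  intro κ γ hκ hγ hγ' _ f hf ϖ hϖ D g h hchar hι
  haveI : Module.Finite (IwasawaAlgebra p) D.X := D.module_finite_holds hγ
  obtain ⟨hX, -⟩ := hW16 W p hp ⟨hgood, hord⟩ hred hκ hγ hγ' hf D ϖ hϖ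
  have hgh : g * h ≠ 0 := mul_ne_zero_of_iota_eq hgood hord hf hϖ D hι
  have hg : g ≠ 0 := fun h0 ↦ hgh (by rw [h0, zero_mul])
  have h1 : lam (g * h) = n := hlam f hf ϖ hϖ (g * h) hι
  have h2 : lam g = lambdaInvariant p D.X := lam_generator_eq_lambdaInvariant D.X hX hg hchar
  obtain ⟨-, h3⟩ := isTorsion_and_le_lambdaInvariant_of_residualDescentBound hW16 hmod hp hgood hord
    hred hμ hD hκ hγ hγ' D
  omega

/-- **Route D, λ-part with parity.** As `lambdaPartAt_of_residualDescentBound`, but with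
`n + e ≤ k + 1`, for `n` EVEN and `Sel_{p^∞}(E/ℚ)` finite (`λ(f_E)` even by Greenberg's Prop. 3.10,
`h310`, PUBLISHED): `λ(h) = n − λ(f_E)` is even and `≤ 1`, hence `0`.
[cite: GreenbergLNM1716, Prop. 3.10] [cite: GreenbergVatsal2000, §2 pp. 25–27]
[cite: Wuthrich2014, Thm. 16 (p. 397)] -/
theorem lambdaPartAt_of_residualDescentBound_of_even
    (hW16 : Wuthrich2014.charIdeal_dvd_padicLFunction)
    (h310 : prop310_selmerCorank_mod_two_eq_lambdaInvariant)
    (hmod : nonempty_modularParametrizationData)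
    (hp : p ≠ 2) (hgood : W.HasGoodReductionAtPrime p) (hord : ¬ (p : ℤ) ∣ W.frobeniusTrace p)
    (hred : ¬ W.HasIrreducibleModPGaloisRep p) (hSel : Finite (W.selmerGroupPInfty p))
    (hμ : AnalyticMuLE W p 0) {k e : ℕ} (hD : ResidualDescentBound W p k e)
    {n : ℕ} (hn : Even n) (hlam : AnalyticLambdaEq W p n) (hne : n + e ≤ k + 1) :
    LambdaPartAt W p := by
  intro κ γ hκ hγ hγ' _ f hf ϖ hϖ D g h hchar hι
  haveI : Module.Finite (IwasawaAlgebra p) D.X := D.module_finite_holds hγ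
  obtain ⟨hX, -⟩ := hW16 W p hp ⟨hgood, hord⟩ hred hκ hγ hγ' hf D ϖ hϖ
  have hgh : g * h ≠ 0 := mul_ne_zero_of_iota_eq hgood hord hf hϖ D hι
  have hg : g ≠ 0 := fun h0 ↦ hgh (by rw [h0, zero_mul])
  have hh : h ≠ 0 := fun h0 ↦ hgh (by rw [h0, mul_zero])
  have h1 : lam (g * h) = n := hlam f hf ϖ hϖ (g * h) hι
  have h2 : lam g = lambdaInvariant p D.X := lam_generator_eq_lambdaInvariant D.X hX hg hchar
  obtain ⟨-, h3⟩ := isTorsion_and_le_lambdaInvariant_of_residualDescentBound hW16 hmod hp hgood hord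
    hred hμ hD hκ hγ hγ' D
  have hcork : W.selmerCorank p = 0 := by
    haveI := hSel
    exact zpCorank_eq_zero_of_finite (W.selmerGroupPInfty p) p
  have heven : Even (lam g) := by
    rw [h2]
    exact prop310_selmerCorank_mod_two_eq_lambdaInvariant.even_lambdaInvariant_of_selmerCorank_eq_zero
      h310 W p hp hκ hγ D hX hcork
  have hgh2 : Even (lam (g * h)) := by rw [h1]; exact hn
  rw [lam_mul hg hh] at h1 hgh2 ⊢
  obtain ⟨a, ha⟩ := heven
  obtain ⟨b, hb⟩ := hgh2
  omega

/-- **Route D with parity: Mazur's main conjecture** from `μ_an(E₀) = 0`, `λ_an(E₀) = n` even,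
`Sel_{p^∞}(E₀/ℚ)` finite, Greenberg's Prop. 3.10, the descent bound `ResidualDescentBound W p k e`
and `n + e ≤ k + 1`. [cite: GreenbergLNM1716, Prop. 3.10] [cite: GreenbergVatsal2000, §2 pp. 25–27]
[cite: Wuthrich2014, Thm. 16 (p. 397)] -/
theorem mazurMainConjecture_of_residualDescentBound_of_even
    (hW16 : Wuthrich2014.charIdeal_dvd_padicLFunction)
    (h310 : prop310_selmerCorank_mod_two_eq_lambdaInvariant)
    (hmod : nonempty_modularParametrizationData)
    (hp : p ≠ 2) (hgood : W.HasGoodReductionAtPrime p) (hord : ¬ (p : ℤ) ∣ W.frobeniusTrace p)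
    (hred : ¬ W.HasIrreducibleModPGaloisRep p) (hSel : Finite (W.selmerGroupPInfty p))
    (hμ : AnalyticMuLE W p 0) {k e : ℕ} (hD : ResidualDescentBound W p k e)
    {n : ℕ} (hn : Even n) (hlam : AnalyticLambdaEq W p n) (hne : n + e ≤ k + 1) :
    MazurMainConjecture W p :=
  (mazurMainConjecture_iff_muPart_and_lambdaPart hW16 hp hgood hord hred).mpr
    ⟨muPartAt_of_analyticMuLE_zero hW16 hp hgood hord hred hμ,
      lambdaPartAt_of_residualDescentBound_of_even hW16 h310 hmod hp hgood hord hred hSel hμ hD hn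
        hlam hne⟩

end Squeeze

/-! ## §3. On the leaf X1 ∩ {r = 0}: route D closes `BSD(E,p)` -/

section Leaf

variable {W : WeierstrassCurve ℚ} [W.IsElliptic] [W.IsGloballyMinimal] {p : ℕ} [Fact p.Prime]

/-- **Route D on the leaf: Mazur's main conjecture at `E₀`** from `μ_an(E₀) = 0`, `λ_an(E₀) = n`, the
descent bound `dim Sel_m(E₀[p]) = k ≤ λ_alg + e` and `n + e ≤ k + 1` — parity is automatic on the leaf
(`λ_an` even: `ParitySqueeze.Leaf.even_of_analyticLambdaEq`; `λ(f_E)` even: Prop. 3.10 at corank `0`,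
Kato finiteness via Gross–Zagier–Kolyvagin). Facts `hW16`, `h310`, `hmod`, `hGZK` all PUBLISHED.
[cite: GreenbergLNM1716, Prop. 3.10] [cite: GreenbergVatsal2000, §2 pp. 25–27]
[cite: Wuthrich2014, Thm. 16 (p. 397)] -/
theorem Leaf.mazurMainConjecture_of_residualDescent
    (hW16 : Wuthrich2014.charIdeal_dvd_padicLFunction)
    (h310 : prop310_selmerCorank_mod_two_eq_lambdaInvariant)
    (hmod : nonempty_modularParametrizationData)
    (hGZK : rank_eq_analyticRank_of_analyticRank_le_one) (hL : RankZero.Leaf W p)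
    (hμ : AnalyticMuLE W p 0) {k e : ℕ} (hD : ResidualDescentBound W p k e)
    {n : ℕ} (hlam : AnalyticLambdaEq W p n) (hne : n + e ≤ k + 1) :
    MazurMainConjecture W p :=
  have hX := isClassX1_of_classX1 hL.classX1
  mazurMainConjecture_of_residualDescentBound_of_even hW16 h310 hmod hX.two_ne
    hX.hasGoodReductionAtPrime hX.not_dvd_frobeniusTrace hX.not_hasIrreducibleModPGaloisRep
    (TamagawaSqueeze.Leaf.finite_selmerGroupPInfty hmod hGZK hL) hμ hD
    (ParitySqueeze.Leaf.even_of_analyticLambdaEq hW16 hmod hL hlam) hlam hne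

/-- **Route D on the leaf, headline: `BSD(E₀, p)`** from `μ_an(E₀) = 0 ∧ λ_an(E₀) = n`, the descent
bound `dim_{𝔽_p} Sel_m(E₀[p]/ℚ_m) = k ≤ λ_alg(E₀) + e` (X1R0-GAPMAP §17.1: GV §2 structure + the
exact Kummer computation over `ℚ(ζ_{p^{m+1}}, E₀[p])`) and `n + e ≤ k + 1`; through
`RankZero.Leaf.mazurMainConjecture_iff_bsdp` (Greenberg 4.1, modularity, Gross–Zagier–Kolyvagin; all
PUBLISHED). Census instance: `44a1 @ 3` — `m = 1` (`ℚ_1 = ℚ(ζ_9)⁺`), `k = 5`, `e = 1 + 1 = 2`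
(`δ = 1`; `d_2 = 0` at the additive prime, `d_11 = 1`, `g_11(1) = 1` at the non-split prime
`11 ≡ −1 (3)`), `n = λ_an = 4`: `4 + 2 ≤ 5 + 1`. [cite: GreenbergVatsal2000, §2 pp. 25–27]
[cite: GreenbergLNM1716, Prop. 3.10 and Thm. 4.1] [cite: Wuthrich2014, Thm. 16 (p. 397)] -/
theorem Leaf.bsdp_of_muZero_of_residualDescent
    (hW16 : Wuthrich2014.charIdeal_dvd_padicLFunction) (hGr : greenberg_charValue_rankZero)
    (h310 : prop310_selmerCorank_mod_two_eq_lambdaInvariant)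
    (hmod : nonempty_modularParametrizationData)
    (hGZK : rank_eq_analyticRank_of_analyticRank_le_one) (hL : RankZero.Leaf W p)
    (hμ : AnalyticMuLE W p 0) {k e : ℕ} (hD : ResidualDescentBound W p k e)
    {n : ℕ} (hlam : AnalyticLambdaEq W p n) (hne : n + e ≤ k + 1) : BSDp W p :=
  (RankZero.Leaf.mazurMainConjecture_iff_bsdp hW16 hGr hmod hGZK hL).mp
    (Leaf.mazurMainConjecture_of_residualDescent hW16 h310 hmod hGZK hL hμ hD hlam hne)

/-- **Consistency (Kato–Wuthrich direction): a descent bound never exceeds `λ_an(E₀)`.** On the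
leaf, with `μ_an(E₀) = 0`, `ResidualDescentBound W p k e` and `λ_an(E₀) = n`: `k ≤ n + e` (the data
exist: modularity, the cyclotomic `κ, γ`, a dual datum; `ϖ·L_p = ι(f_E·h)` gives
`n = λ(f_E) + λ(h) ≥ λ(f_E) = λ(X) ≥ k − e`). This is the FALSIFICATION TEST of the census
(X1R0-GAPMAP §17.4: `D_m = k − e ≤ λ_an` at every computed class, 0 violations).
[cite: GreenbergVatsal2000, §2 pp. 25–27] [cite: Wuthrich2014, Thm. 16 (p. 397)] -/
theorem Leaf.le_of_residualDescentBound
    (hW16 : Wuthrich2014.charIdeal_dvd_padicLFunction) (hmod : nonempty_modularParametrizationData)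
    (hL : RankZero.Leaf W p) (hμ : AnalyticMuLE W p 0) {k e : ℕ} (hD : ResidualDescentBound W p k e)
    {n : ℕ} (hlam : AnalyticLambdaEq W p n) : k ≤ n + e := by
  have hX := isClassX1_of_classX1 hL.classX1
  haveI : NeZero (W.conductorNorm ℤ) := ⟨(W.conductorNorm_pos_holds).ne'⟩
  obtain ⟨κ, hκ, γ, hγ, hγ'⟩ := exists_isCyclotomic_isTopGenerator_isCyclotomicVariable_holds p
  obtain ⟨D⟩ := W.nonempty_selmerDualData_holds κ γ hγ
  haveI : Module.Finite (IwasawaAlgebra p) D.X := D.module_finite_holds hγ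
  obtain ⟨hXt, f, ϖ, g, h, hf, hϖ, hchar, hι⟩ := isTorsion_and_exists_factorisation hW16 hmod
    hX.two_ne hX.hasGoodReductionAtPrime hX.not_dvd_frobeniusTrace hX.not_hasIrreducibleModPGaloisRep
    hκ hγ hγ' D
  have hgh : g * h ≠ 0 :=
    mul_ne_zero_of_iota_eq hX.hasGoodReductionAtPrime hX.not_dvd_frobeniusTrace hf hϖ D hι
  have hg0 : g ≠ 0 := fun h0 ↦ hgh (by rw [h0, zero_mul])
  have hh0 : h ≠ 0 := fun h0 ↦ hgh (by rw [h0, mul_zero])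
  have h1 : lam (g * h) = n := hlam f hf ϖ hϖ (g * h) hι
  have h2 : lam g = lambdaInvariant p D.X := lam_generator_eq_lambdaInvariant D.X hXt hg0 hchar
  obtain ⟨-, h3⟩ := isTorsion_and_le_lambdaInvariant_of_residualDescentBound hW16 hmod hX.two_ne
    hX.hasGoodReductionAtPrime hX.not_dvd_frobeniusTrace hX.not_hasIrreducibleModPGaloisRep hμ hD hκ
    hγ hγ' D
  have h4 : lam g ≤ lam (g * h) := lam_le_lam_mul hg0 hh0
  omega

end Leaf

end Summit.BirchSwinnertonDyer.Rank1Residual.X1.ResidualDescent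

end
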